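import Mathlib
import Literature.NumberTheory.LFunctions.WashingtonSinnottTheorem

/-!
# Hodge locus census, cell V3-XT, `N = 1` — the SUM / PAIR law for `j(O_D)` at the primes above `2` (`2 ∣ D₀`, `2 ∤ f`): the valuation-theoretic kernel

HONEST FRAMING: certified instances and evidence bearing on the general Hodge conjecture; no claim.
This file is a HELPER for the engine-B census of the `α₀`-row (`θ = j(O_D)`, local factors of the class
polynomial `H_D` over `ℚ₂`) of the Hodge-locus programme (`stmt-HodgeConjecture-16267`); it proves no
statement about Hodge classes.

THE LAW (observed by engine A, abs-1 gen 22, on the quadratic `ℚ₂`-factors `g = x² − σ₁x + σ₂` of `H_D`,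
`D = D₀f²`, `2 ∣ D₀`, `2 ∤ f`, `D ≠ −4`; countersigned by engine B, abs-2 gen 25, on `|D| ≤ 10⁴`):
with `b := v₂(θ − 1728)` (an integer `≥ 7`),
  SUM  `v₂(σ₁ − 3456) = 2b − 6`,   PAIR  `v₂(A(σ₁ − 3456) + C·g(1728)) = 2b + 5`,
where `A = 81663349824 = 2⁶·1275989841` and `C = 39114495` are the linear and the bilinear Taylor
coefficient of the modular polynomial `Φ₂` at `(1728, 1728)`.

THE EXPLANATION (engine B, abs-2 gen 26, `DERIVATIONS_engineB.md` §20): for every root `θ = j(E)` of `H_D`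
in `ℚ̄₂` the Galois conjugate `θ' := Frob_{𝔭₂}(θ)` (`𝔭₂² = 2O_K`, `𝔭₂` unramified in the ring class field,
its Frobenius generating the decomposition group) is the `j`-invariant of the `2`-isogenous curve
`E/E[𝔭₂]`, so `Φ₂(θ, θ') = 0`, and `v₂(θ' − 1728) = v₂(θ − 1728) = b`.  Writing `θ = 1728 + U`,
`θ' = 1728 + W`, the Taylor expansion
  `Φ₂(1728 + U, 1728 + W) = A(U + W) + C·UW − 571536(U² + W²) − 1968(U²W + UW²) − U²W² + U³ + W³`
(`571536 = 2⁴·35721`, `1968 = 2⁴·123`, `C` odd) and the ultrametric inequality force, as soon as `b ≥ 7`,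
  `v₂(U + W) = 2b − 6`  and  `v₂(A(U + W) + C·UW) = v₂(571536(U² + W²)) = 2b + 5`.
For a quadratic factor `θ'` is the other root, `U + W = σ₁ − 3456`, `UW = g(1728)`: this is SUM / PAIR;
for the quartic factors it is the new prediction checked by engine B's job spB26 (`θ' = σ_W θ`).

What is kernel-checked here, for an ARBITRARY valuation `v : K → Γ₀` on a field with `v 2 < 1`, `2 ≠ 0`
(Mathlib's multiplicative convention; `v x = (v 2)^n` renders `v₂(x) = n`):
* `phi2_taylor` — the displayed Taylor expansion of `Φ₂` at `(1728, 1728)` is a polynomial identity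
  (any commutative ring); `phi2_at_1728` — `Φ₂(1728, 1728) = 0`;
* `val_odd_natCast` (using the landed `Literature.NumberTheory.LFunctions.valuation_natCast_le_one`), `val_A`, `val_C`, `val_P`, `val_Q`, `val_three` — `v` of the constants;
* `sum_law`, `pair_law`, `sum_pair_law` — the two valuation identities above from `Φ₂(1728+U, 1728+W) = 0`,
  `v U = v W = (v 2)^b`, `7 ≤ b`.
The arithmetic input (`θ' = Frob(θ)` is `2`-isogenous, `b ≥ 7`, `b ∈ ℤ`) is NOT formalised here; it is
the cited / separately certified part of the derivation (abs-1 THEOREM T-1728@2 gives `b = 6 + Σ_U v₂(N − b_U²) ≥ 7`).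
-/

set_option linter.dupNamespace false

namespace Summit.HodgeConjecture.HodgeConjecture.HodgeLocus.Census.SumPairLaw

/-- The classical modular polynomial of level `2` (coefficients as in the census code; the modular equation of level `2`). [cite: Cox2013, §13.A] -/
def Phi2 {R : Type*} [CommRing R] (X Y : R) : R :=
  X ^ 3 + Y ^ 3 - X ^ 2 * Y ^ 2 + 1488 * (X ^ 2 * Y + X * Y ^ 2) - 162000 * (X ^ 2 + Y ^ 2)
    + 40773375 * (X * Y) + 8748000000 * (X + Y) - 157464000000000

/-- `Φ₂(1728, 1728) = 0` (`j = 1728` admits the cyclic `2`-isogeny `1 + i`). -/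
theorem phi2_at_1728 : Phi2 (1728 : ℤ) 1728 = 0 := by norm_num [Phi2]

/-- `Φ₂(8000, 8000) = 0` (`D = −8`: `√−2` is a `2`-isogeny of `j = 8000` to itself). -/
theorem phi2_at_8000 : Phi2 (8000 : ℤ) 8000 = 0 := by norm_num [Phi2]

/-- The Taylor expansion of `Φ₂` at `(1728, 1728)` — a polynomial identity in any commutative ring. -/
theorem phi2_taylor {R : Type*} [CommRing R] (U W : R) :
    Phi2 (1728 + U) (1728 + W) = 81663349824 * (U + W) + 39114495 * (U * W) - 571536 * (U ^ 2 + W ^ 2)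
      - 1968 * (U ^ 2 * W + U * W ^ 2) - U ^ 2 * W ^ 2 + U ^ 3 + W ^ 3 := by
  unfold Phi2; ring

/-- The integer constants: `A = 2⁶·odd`, `C` odd, `571536 = 2⁴·odd`, `1968 = 2⁴·odd`. -/
theorem constants_two_adic :
    (81663349824 : ℕ) = 2 ^ 6 * (2 * 637994920 + 1) ∧ (39114495 : ℕ) = 2 * 19557247 + 1 ∧
    (571536 : ℕ) = 2 ^ 4 * (2 * 17860 + 1) ∧ (1968 : ℕ) = 2 ^ 4 * (2 * 61 + 1) := by norm_num

section Valued

variable {K : Type*} [Field K] {Γ₀ : Type*} [LinearOrderedCommGroupWithZero Γ₀] (v : Valuation K Γ₀)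

/-- Odd integers are units for a valuation with `v 2 < 1`. -/
theorem val_odd_natCast (h2 : v (2 : K) < 1) (n : ℕ) : v ((2 * n + 1 : ℕ) : K) = 1 := by
  have hlt : v ((2 * n : ℕ) : K) < v (1 : K) := by
    rw [v.map_one, Nat.cast_mul, map_mul, Nat.cast_ofNat]
    calc v (2 : K) * v (n : K) ≤ v (2 : K) * 1 := mul_le_mul' le_rfl (Literature.NumberTheory.LFunctions.valuation_natCast_le_one v n)
      _ = v 2 := mul_one _
      _ < 1 := h2
  have : v ((1 : K) + ((2 * n : ℕ) : K)) = v (1 : K) := Valuation.map_add_eq_of_lt_left _ hlt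
  rw [Nat.cast_succ, add_comm, this, v.map_one]

/-- `v A = (v 2)^6` for `A = 81663349824 = 2⁶·1275989841`. -/
theorem val_A (h2 : v (2 : K) < 1) : v (81663349824 : K) = v 2 ^ 6 := by
  have : (81663349824 : K) = (2 : K) ^ 6 * ((2 * 637994920 + 1 : ℕ) : K) := by push_cast; norm_num
  rw [this, map_mul, map_pow, val_odd_natCast v h2, mul_one]

/-- `v C = 1` for the odd constant `C = 39114495`. -/
theorem val_C (h2 : v (2 : K) < 1) : v (39114495 : K) = 1 := by
  have : (39114495 : K) = ((2 * 19557247 + 1 : ℕ) : K) := by push_cast; norm_num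
  rw [this, val_odd_natCast v h2]

/-- `v 571536 = (v 2)^4` (`571536 = 2⁴·35721`). -/
theorem val_P (h2 : v (2 : K) < 1) : v (571536 : K) = v 2 ^ 4 := by
  have : (571536 : K) = (2 : K) ^ 4 * ((2 * 17860 + 1 : ℕ) : K) := by push_cast; norm_num
  rw [this, map_mul, map_pow, val_odd_natCast v h2, mul_one]

/-- `v 1968 = (v 2)^4` (`1968 = 2⁴·123`). -/
theorem val_Q (h2 : v (2 : K) < 1) : v (1968 : K) = v 2 ^ 4 := by
  have : (1968 : K) = (2 : K) ^ 4 * ((2 * 61 + 1 : ℕ) : K) := by push_cast; norm_num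
  rw [this, map_mul, map_pow, val_odd_natCast v h2, mul_one]

/-- `v 3 = 1`. -/
theorem val_three (h2 : v (2 : K) < 1) : v (3 : K) = 1 := by
  have : (3 : K) = ((2 * 1 + 1 : ℕ) : K) := by push_cast; norm_num
  rw [this, val_odd_natCast v h2]

/-- powers of an element `0 < t < 1` of the value group strictly decrease. -/
theorem pow_succ_lt_one {t : Γ₀} (ht1 : t < 1) (k : ℕ) : t ^ (k + 1) < 1 := by
  induction k with
  | zero => simpa using ht1
  | succ k ih =>
    calc t ^ (k + 1 + 1) = t ^ (k + 1) * t := pow_succ _ _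
      _ ≤ t ^ (k + 1) * 1 := mul_le_mul' le_rfl (le_of_lt ht1)
      _ = t ^ (k + 1) := mul_one _
      _ < 1 := ih

/-- `t^n < t^m` for `m < n` when `0 ≠ t < 1`. -/
theorem pow_lt_pow_of_lt {t : Γ₀} (ht0 : t ≠ 0) (ht1 : t < 1) {m n : ℕ} (hmn : m < n) :
    t ^ n < t ^ m := by
  obtain ⟨k, rfl⟩ := Nat.exists_eq_add_of_lt hmn
  have hpos : 0 < t ^ m := zero_lt_iff.mpr (pow_ne_zero _ ht0)
  calc t ^ (m + k + 1) = t ^ (k + 1) * t ^ m := by rw [← pow_add]; congr 1; omega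
    _ < 1 * t ^ m := mul_lt_mul_of_pos_right (pow_succ_lt_one ht1 k) hpos
    _ = t ^ m := one_mul _

/-- `t^n ≤ t^m` for `m ≤ n` when `0 ≠ t < 1`. -/
theorem pow_le_pow_of_le {t : Γ₀} (ht0 : t ≠ 0) (ht1 : t < 1) {m n : ℕ} (hmn : m ≤ n) :
    t ^ n ≤ t ^ m := by
  rcases Nat.eq_or_lt_of_le hmn with h | h
  · rw [h]
  · exact le_of_lt (pow_lt_pow_of_lt ht0 ht1 h)

/-- SUM and PAIR.  Hypotheses: `v 2 < 1`, `2 ≠ 0` in `K`; `Φ₂(1728 + U, 1728 + W) = 0`; `v U = v W = (v 2)^b`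
with `7 ≤ b`.  Conclusions: `v (U + W) = (v 2)^(2b − 6)` and `v (A(U + W) + C·UW) = (v 2)^(2b + 5)`. -/
theorem sum_pair_law (h2 : v (2 : K) < 1) (h20 : (2 : K) ≠ 0) {U W : K} {b : ℕ} (hb : 7 ≤ b)
    (hΦ : Phi2 (1728 + U) (1728 + W) = 0) (hU : v U = v 2 ^ b) (hW : v W = v 2 ^ b) :
    v (U + W) = v 2 ^ (2 * b - 6) ∧
      v (81663349824 * (U + W) + 39114495 * (U * W)) = v 2 ^ (2 * b + 5) := by
  obtain ⟨k, rfl⟩ := Nat.exists_eq_add_of_le hb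
  set t : Γ₀ := v 2 with ht_def
  have ht0 : t ≠ 0 := (Valuation.ne_zero_iff v).mpr h20
  have e1 : 2 * (7 + k) - 6 = 8 + 2 * k := by omega
  have e2 : 2 * (7 + k) + 5 = 19 + 2 * k := by omega
  rw [e1, e2]
  -- name the pieces
  set S := U + W with hS
  set Pr := U * W with hPr
  have hA := val_A v h2
  have hC := val_C v h2
  have hP := val_P v h2
  have hQ := val_Q v h2
  have h3 := val_three v h2
  -- valuations of the monomials
  have vPr : v Pr = t ^ (14 + 2 * k) := by
    rw [hPr, map_mul, hU, hW, ← pow_add]; congr 1; omega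
  have vU2 : v (U ^ 2) = t ^ (14 + 2 * k) := by rw [map_pow, hU, ← pow_mul]; congr 1; omega
  have vW2 : v (W ^ 2) = t ^ (14 + 2 * k) := by rw [map_pow, hW, ← pow_mul]; congr 1; omega
  have vU3 : v (U ^ 3) = t ^ (21 + 3 * k) := by rw [map_pow, hU, ← pow_mul]; congr 1; omega
  have vW3 : v (W ^ 3) = t ^ (21 + 3 * k) := by rw [map_pow, hW, ← pow_mul]; congr 1; omega
  have vPr2 : v (U ^ 2 * W ^ 2) = t ^ (28 + 4 * k) := by
    rw [map_mul, vU2, vW2, ← pow_add]; congr 1; omega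
  have vSq_le : v (U ^ 2 + W ^ 2) ≤ t ^ (14 + 2 * k) :=
    le_trans (v.map_add_le_max' _ _) (max_le (le_of_eq vU2) (le_of_eq vW2))
  have vS_le : v S ≤ t ^ (7 + k) := by
    rw [hS]; exact le_trans (v.map_add_le_max' _ _) (max_le (le_of_eq hU) (le_of_eq hW))
  -- the equation: A S = -(C Pr) + 571536 (U²+W²) + 1968 Pr S + U²W² - U³ - W³
  have hid : (81663349824 : K) * S =
      -(39114495 * Pr) + (571536 * (U ^ 2 + W ^ 2) + 1968 * (Pr * S) + U ^ 2 * W ^ 2 - U ^ 3 - W ^ 3) := by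
    have := phi2_taylor U W
    rw [hΦ] at this
    rw [hS, hPr]; linear_combination -this
  -- dominant term
  have vMain : v (-(39114495 * Pr : K)) = t ^ (14 + 2 * k) := by
    rw [Valuation.map_neg, map_mul, hC, one_mul, vPr]
  have lt1 : v (571536 * (U ^ 2 + W ^ 2)) < t ^ (14 + 2 * k) := by
    rw [map_mul, hP]
    calc t ^ 4 * v (U ^ 2 + W ^ 2) ≤ t ^ 4 * t ^ (14 + 2 * k) := mul_le_mul' le_rfl vSq_le
      _ = t ^ (18 + 2 * k) := by rw [← pow_add]; congr 1; omega
      _ < t ^ (14 + 2 * k) := pow_lt_pow_of_lt ht0 h2 (by omega)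
  have lt2 : v (1968 * (Pr * S)) < t ^ (14 + 2 * k) := by
    rw [map_mul, map_mul, hQ, vPr]
    calc t ^ 4 * (t ^ (14 + 2 * k) * v S) ≤ t ^ 4 * (t ^ (14 + 2 * k) * t ^ (7 + k)) :=
          mul_le_mul' le_rfl (mul_le_mul' le_rfl vS_le)
      _ = t ^ (25 + 3 * k) := by rw [← pow_add, ← pow_add]; congr 1; omega
      _ < t ^ (14 + 2 * k) := pow_lt_pow_of_lt ht0 h2 (by omega)
  have lt3 : v (U ^ 2 * W ^ 2) < t ^ (14 + 2 * k) := by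
    rw [vPr2]; exact pow_lt_pow_of_lt ht0 h2 (by omega)
  have lt4 : v (U ^ 3) < t ^ (14 + 2 * k) := by
    rw [vU3]; exact pow_lt_pow_of_lt ht0 h2 (by omega)
  have lt5 : v (W ^ 3) < t ^ (14 + 2 * k) := by
    rw [vW3]; exact pow_lt_pow_of_lt ht0 h2 (by omega)
  have vRest : v (571536 * (U ^ 2 + W ^ 2) + 1968 * (Pr * S) + U ^ 2 * W ^ 2 - U ^ 3 - W ^ 3)
      < t ^ (14 + 2 * k) := by
    refine Valuation.map_sub_lt v (Valuation.map_sub_lt v ?_ lt4) lt5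
    exact Valuation.map_add_lt v (Valuation.map_add_lt v lt1 lt2) lt3
  have vAS : v ((81663349824 : K) * S) = t ^ (14 + 2 * k) := by
    rw [hid, Valuation.map_add_eq_of_lt_left _ (by rw [vMain]; exact vRest), vMain]
  -- SUM
  have vS : v S = t ^ (8 + 2 * k) := by
    rw [map_mul, hA, ← ht_def] at vAS
    have hne : t ^ 6 ≠ 0 := pow_ne_zero _ ht0
    have : t ^ 6 * v S = t ^ 6 * t ^ (8 + 2 * k) := by rw [vAS, ← pow_add]; congr 1; omega
    exact mul_left_cancel₀ hne this
  refine ⟨vS, ?_⟩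
  -- PAIR: A S + C Pr = 571536 (U²+W²) + 1968 Pr S + U²W² - (U³ + W³)
  have hid2 : (81663349824 : K) * S + 39114495 * Pr =
      571536 * (U ^ 2 + W ^ 2) + (1968 * (Pr * S) + U ^ 2 * W ^ 2 - (U ^ 3 + W ^ 3)) := by
    linear_combination hid
  -- v (U² + W²) = t^(15+2k) via U²+W² = -(2 Pr) + S²
  have hsq : U ^ 2 + W ^ 2 = -(2 * Pr) + S ^ 2 := by rw [hS, hPr]; ring
  have v2Pr : v (-(2 * Pr : K)) = t ^ (15 + 2 * k) := by
    rw [Valuation.map_neg, map_mul, vPr, ← ht_def, ← pow_succ']; congr 1; omega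
  have vS2 : v (S ^ 2) = t ^ (16 + 4 * k) := by rw [map_pow, vS, ← pow_mul]; congr 1; omega
  have vSq : v (U ^ 2 + W ^ 2) = t ^ (15 + 2 * k) := by
    rw [hsq, Valuation.map_add_eq_of_lt_left _ (by rw [v2Pr, vS2]; exact pow_lt_pow_of_lt ht0 h2 (by omega)), v2Pr]
  have vLead : v (571536 * (U ^ 2 + W ^ 2)) = t ^ (19 + 2 * k) := by
    rw [map_mul, hP, vSq, ← pow_add]; congr 1; omega
  have m1 : v (1968 * (Pr * S)) < t ^ (19 + 2 * k) := by
    rw [map_mul, map_mul, hQ, vPr, vS, ← pow_add, ← pow_add]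
    exact pow_lt_pow_of_lt ht0 h2 (by omega)
  have m2 : v (U ^ 2 * W ^ 2) < t ^ (19 + 2 * k) := by
    rw [vPr2]; exact pow_lt_pow_of_lt ht0 h2 (by omega)
  -- U³ + W³ = S (S² - 3 Pr)
  have hcube : U ^ 3 + W ^ 3 = S * (S ^ 2 - 3 * Pr) := by rw [hS, hPr]; ring
  have m3 : v (U ^ 3 + W ^ 3) < t ^ (19 + 2 * k) := by
    rw [hcube, map_mul, vS]
    have hx : v (S ^ 2) ≤ t ^ (14 + 2 * k) := vS2.trans_le (pow_le_pow_of_le ht0 h2 (by omega))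
    have hy : v (-(3 * Pr)) ≤ t ^ (14 + 2 * k) := by rw [Valuation.map_neg, map_mul, h3, one_mul, vPr]
    have hin : v (S ^ 2 - 3 * Pr) ≤ t ^ (14 + 2 * k) := by
      rw [sub_eq_add_neg]; exact le_trans (v.map_add_le_max' _ _) (max_le hx hy)
    calc t ^ (8 + 2 * k) * v (S ^ 2 - 3 * Pr) ≤ t ^ (8 + 2 * k) * t ^ (14 + 2 * k) := mul_le_mul' le_rfl hin
      _ = t ^ (22 + 4 * k) := by rw [← pow_add]; congr 1; omega
      _ < t ^ (19 + 2 * k) := pow_lt_pow_of_lt ht0 h2 (by omega)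
  have vTail : v (1968 * (Pr * S) + U ^ 2 * W ^ 2 - (U ^ 3 + W ^ 3)) < t ^ (19 + 2 * k) :=
    Valuation.map_sub_lt v (Valuation.map_add_lt v m1 m2) m3
  rw [hid2, Valuation.map_add_eq_of_lt_left _ (by rw [vLead]; exact vTail), vLead]

/-- SUM alone, in the shape used by the census tables (`σ₁ − 3456 = U + W`). -/
theorem sum_law (h2 : v (2 : K) < 1) (h20 : (2 : K) ≠ 0) {U W : K} {b : ℕ} (hb : 7 ≤ b)
    (hΦ : Phi2 (1728 + U) (1728 + W) = 0) (hU : v U = v 2 ^ b) (hW : v W = v 2 ^ b) :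
    v ((1728 + U) + (1728 + W) - 3456) = v 2 ^ (2 * b - 6) := by
  rw [show (1728 + U) + (1728 + W) - 3456 = U + W by ring]
  exact (sum_pair_law v h2 h20 hb hΦ hU hW).1

/-- PAIR alone, in the shape used by the census tables (`g(1728) = UW` for `g = (x − θ)(x − θ')`). -/
theorem pair_law (h2 : v (2 : K) < 1) (h20 : (2 : K) ≠ 0) {U W : K} {b : ℕ} (hb : 7 ≤ b)
    (hΦ : Phi2 (1728 + U) (1728 + W) = 0) (hU : v U = v 2 ^ b) (hW : v W = v 2 ^ b) :
    v (81663349824 * ((1728 + U) + (1728 + W) - 3456)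
        + 39114495 * ((1728 - (1728 + U)) * (1728 - (1728 + W)))) = v 2 ^ (2 * b + 5) := by
  rw [show (1728 - (1728 + U)) * (1728 - (1728 + W)) = U * W by ring,
    show (1728 + U) + (1728 + W) - 3456 = U + W by ring]
  exact (sum_pair_law v h2 h20 hb hΦ hU hW).2

end Valued

end Summit.HodgeConjecture.HodgeConjecture.HodgeLocus.Census.SumPairLaw
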